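import Summits.HubbardSuperconductivity.HubbardSuperconductivity.Theorems.AnisotropyChordTransferFibre3Hole2Quarter

/-!
# Route `AnisotropyChord` / H0 rotor rung: HOLE₂(.75) at `L = 33` — kernel facts, part b (51 of the 152 `D₄`-classes)

KERNEL FACT for the twice-punctured `33 × 33` torus (zero data): the quarter-table interval Birman–Schwinger checker `Hole2.checkRepsQ`
(`…Fibre3Hole2Quarter`) accepts the listed separations at the certified constant `g_33 ≥ ¾ε₁(33)`, by ONE `decide +kernel`
(`maxHeartbeats 400000` pre-budgeted: the quarter Green table alone is ¾L³ interval operations, recomputed in each part).  The parts are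
glued in `…Hole2L33` and turned into `TwoHoleGap 33 (3/4·eps1 33)` by `Hole2.twoHoleGap_of_checkRepsQ_repList` (`…Fibre3Hole2Cover`).
`L = 33` lies just above the FIN range `9 ≤ L ≤ 32` (`…Hole2FinRange`); HOLE₂ per `L` is needed in the analytic regime as well.
Prover seat `hubbard-h0-rotor-p3` g3; helper for stmt-HubbardSuperconductivity-19089 (`--supports`, helper class).
WHAT THIS IS NOT: nothing here proves superconductivity in the Hubbard model (rotor TARGET as worded stays FALSE, g15 verdict);
kernel facts for ONE input (HOLE₂(.75) at one `L`) of ONE conditional reduction (rung 19089). Tree imports only; no sorry, no `native_decide`.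
-/

set_option linter.dupNamespace false
set_option autoImplicit false

namespace Summit.HubbardSuperconductivity.HubbardSuperconductivity.Theorems.AnisotropyChord.Transfer.Fibre3

namespace Hole2

/-- `D₄`-representatives of the nonzero separations of the `33 × 33` torus, part b. [folklore] -/
def reps33b : List (ℕ × ℕ) := [(9, 7), (9, 8), (9, 9), (10, 0), (10, 1), (10, 2), (10, 3), (10, 4), (10, 5), (10, 6), (10, 7), (10, 8), (10, 9), (10, 10), (11, 0), (11, 1), (11, 2), (11, 3), (11, 4), (11, 5), (11, 6), (11, 7), (11, 8), (11, 9), (11, 10), (11, 11), (12, 0), (12, 1), (12, 2), (12, 3), (12, 4), (12, 5), (12, 6), (12, 7), (12, 8), (12, 9), (12, 10), (12, 11), (12, 12), (13, 0), (13, 1), (13, 2), (13, 3), (13, 4), (13, 5), (13, 6), (13, 7), (13, 8), (13, 9), (13, 10), (13, 11)]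

set_option maxHeartbeats 400000 in
/-- kernel fact: part b passes the quarter-table interval Birman–Schwinger test at `g_33 ≥ ¾ε₁(33)`. [folklore] -/
theorem checkRepsQ_33b : checkRepsQ 33 reps33b = true := by
  decide +kernel

end Hole2

end Summit.HubbardSuperconductivity.HubbardSuperconductivity.Theorems.AnisotropyChord.Transfer.Fibre3
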